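import Literature.Probability.RandomPlanarGeometry.SAWPulledLargeForceExpansionZdMonic
import Mathlib.Analysis.Polynomial.Basic
import HarnessLib

/-!
# The large-force coefficients `c_k^{(d)}` on `ℤ^{d+1}`: `c_k^{(d)} ~ (−1)^{k−1}(2d)^{k−1}` as `d → ∞`;
# eventual sign law and eventual alternation in every dimension window

Topic `Literature/Probability/RandomPlanarGeometry` (a corollary leaf over `SAWPulledLargeForceExpansionZdMonic.lean`:
`exists_int_polynomial_largeForceCoeffZd_monic` — for `k ≥ 2` there is `S_k ∈ ℤ[X]`, `deg S_k = k − 1`, leading coefficient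
`(−1)^{k−1}`, with `c_k^{(d)} = S_k(2d)` for every `d`; and Mathlib's `Polynomial.isEquivalent_atTop_lead`).

The planar large-force expansion `e^{λ_B(y)} = y + 2 − 2/y + 6/y² − 20/y³ + …` is NOT alternating: `c_{11}(ℤ²) = 111428 > 0` and
`c_{12}(ℤ²) ≥ 105852 > 0` (`SAWPulledLargeForceExpansionCoefficients`, `SAWPulledLargeForceEleventhOrder`).  In high dimension the
picture is the clean one: since `c_k^{(d)}` is a signed-monic integer polynomial of degree `k − 1` in `σ = 2d`,

* ★★ `isEquivalent_largeForceCoeffZd (hk : 2 ≤ k) : (d ↦ c_k^{(d)}) ~[atTop] (d ↦ (−1)^{k−1}(2d)^{k−1})` and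
  `tendsto_largeForceCoeffZd_div_pow : c_k^{(d)}/(2d)^{k−1} → (−1)^{k−1}` (`d → ∞`);
* ★★ **`eventually_sign_largeForceCoeffZd (hk : 1 ≤ k) : ∀ᶠ d, 0 < (−1)^{k−1} · c_k^{(d)}`** — the sign law `sgn c_k^{(d)} = (−1)^{k−1}`
  holds for every `k ≥ 1` once `d ≥ d₀(k)`;
* ★★ **`eventually_alternating_largeForceCoeffZd (K : ℕ) : ∀ᶠ d, ∀ k, 1 ≤ k → k ≤ K → c_k^{(d)} · c_{k+1}^{(d)} < 0`** — for every
  order window `K` the expansion is ALTERNATING through order `K + 1` in all sufficiently high dimensions: the planar non-alternation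
  at orders `11, 12` is a low-dimensional phenomenon.

Printed status: first order (`c_1 = 2d`) is Janse van Rensburg–Whittington (2013, §3.2 Theorem 8); the lane's data (`k ≤ 12`) show the sign
law for every `d ≥ 2`, which remains open as an all-`d` statement.  Provenance: lane «pcv-sawmu», a-p3 g26 (2026-08-28).  PURE STD.
-/

noncomputable section

open Filter Topology Asymptotics
open Literature.Probability.RandomPlanarGeometry.SAW

namespace Literature.Probability.RandomPlanarGeometry.SAW.Zd

/-- ★★ **`c_k^{(d)} ~ (−1)^{k−1}(2d)^{k−1}` as `d → ∞`** for every `k ≥ 2` (signed-monic of degree `k − 1` in `2d`).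
[cite: JansevanRensburgWhittington2013, §3.2 Theorem 8 (arXiv v4 p. 11)] -/
theorem isEquivalent_largeForceCoeffZd {k : ℕ} (hk : 2 ≤ k) :
    (fun d : ℕ => ((largeForceCoeffZd d k : ℤ) : ℝ)) ~[atTop] fun d : ℕ => (-1 : ℝ) ^ (k - 1) * (2 * (d : ℝ)) ^ (k - 1) := by
  obtain ⟨S, hdeg, hlc, -, hS⟩ := exists_int_polynomial_largeForceCoeffZd_monic hk
  set P : Polynomial ℝ := S.map (Int.castRingHom ℝ) with hP
  have hPdeg : P.natDegree = k - 1 := by rw [hP, Polynomial.natDegree_map_eq_of_injective Int.cast_injective, hdeg]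
  have hPlc : P.leadingCoeff = (-1) ^ (k - 1) := by
    rw [hP, Polynomial.leadingCoeff_map_of_injective Int.cast_injective, hlc, map_pow, map_neg, map_one]
  have hlead := Polynomial.isEquivalent_atTop_lead P
  have h2 : Tendsto (fun d : ℕ => 2 * (d : ℝ)) atTop atTop :=
    (tendsto_natCast_atTop_atTop (R := ℝ)).const_mul_atTop two_pos
  have h3 := hlead.comp_tendsto h2
  rw [hPdeg, hPlc] at h3
  refine (h3.congr_left ?_)
  refine Filter.Eventually.of_forall fun d => ?_
  show (P.eval (2 * (d : ℝ))) = ((largeForceCoeffZd d k : ℤ) : ℝ)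
  rw [hS d, hP, show (2 * (d : ℝ)) = ((2 * (d : ℤ) : ℤ) : ℝ) by push_cast; ring, Polynomial.eval_intCast_map,
    Int.cast_id, eq_intCast]

/-- ★★ `c_k^{(d)}/(2d)^{k−1} → (−1)^{k−1}` as `d → ∞` (`k ≥ 2`). [cite: JansevanRensburgWhittington2013, §3.2 Theorem 8 (arXiv v4 p. 11)] -/
theorem tendsto_largeForceCoeffZd_div_pow {k : ℕ} (hk : 2 ≤ k) :
    Tendsto (fun d : ℕ => ((largeForceCoeffZd d k : ℤ) : ℝ) / (2 * (d : ℝ)) ^ (k - 1)) atTop (𝓝 ((-1 : ℝ) ^ (k - 1))) := by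
  have h := isEquivalent_largeForceCoeffZd hk
  have hv : ∀ᶠ d : ℕ in atTop, (-1 : ℝ) ^ (k - 1) * (2 * (d : ℝ)) ^ (k - 1) ≠ 0 := by
    filter_upwards [eventually_gt_atTop 0] with d hd
    exact mul_ne_zero (pow_ne_zero _ (by norm_num)) (pow_ne_zero _ (by positivity))
  have h1 := (isEquivalent_iff_tendsto_one hv).1 h
  have h2 := h1.const_mul ((-1 : ℝ) ^ (k - 1))
  rw [mul_one] at h2
  refine h2.congr' ?_
  filter_upwards [eventually_gt_atTop 0] with d hd
  have hp0 : (2 * (d : ℝ)) ^ (k - 1) ≠ 0 := pow_ne_zero _ (by positivity)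
  have hm0 : ((-1 : ℝ) ^ (k - 1)) ≠ 0 := pow_ne_zero _ (by norm_num)
  simp only [Pi.div_apply]
  rw [mul_div_assoc', div_eq_div_iff (mul_ne_zero hm0 hp0) hp0]
  ring

/-- ★★ **EVENTUAL SIGN LAW**: for every `k ≥ 1`, `0 < (−1)^{k−1}·c_k^{(d)}` for all sufficiently large `d` (i.e. `sgn c_k^{(d)} = (−1)^{k−1}`
eventually in the dimension; `k = 1`: `c_1^{(d)} = 2d > 0` for `d ≥ 1`). [cite: JansevanRensburgWhittington2013, §3.2 Theorem 8 (arXiv v4 p. 11)] -/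
theorem eventually_sign_largeForceCoeffZd {k : ℕ} (hk : 1 ≤ k) :
    ∀ᶠ d : ℕ in atTop, (0 : ℝ) < (-1) ^ (k - 1) * ((largeForceCoeffZd d k : ℤ) : ℝ) := by
  rcases Nat.lt_or_ge k 2 with h1 | h2
  · obtain rfl : k = 1 := by omega
    filter_upwards [eventually_ge_atTop 1] with d hd
    rw [largeForceCoeffZd_at_one]
    push_cast
    simp only [pow_zero, one_mul]
    positivity
  · have ht := tendsto_largeForceCoeffZd_div_pow h2
    -- eventually the ratio is `> 0` when `k − 1` is even, `< 0` when odd; multiply back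
    have hev : ∀ᶠ d : ℕ in atTop, (0 : ℝ) < (-1) ^ (k - 1) * (((largeForceCoeffZd d k : ℤ) : ℝ) / (2 * (d : ℝ)) ^ (k - 1)) := by
      have hlim : Tendsto (fun d : ℕ => (-1 : ℝ) ^ (k - 1) * (((largeForceCoeffZd d k : ℤ) : ℝ) / (2 * (d : ℝ)) ^ (k - 1)))
          atTop (𝓝 ((-1 : ℝ) ^ (k - 1) * (-1) ^ (k - 1))) := ht.const_mul _
      have hone : ((-1 : ℝ) ^ (k - 1)) * (-1 : ℝ) ^ (k - 1) = 1 := by rw [← mul_pow]; norm_num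
      rw [hone] at hlim
      exact (hlim.eventually (eventually_gt_nhds one_pos)).mono fun d hd => hd
    filter_upwards [hev, eventually_gt_atTop 0] with d hd hd0
    have hp : (0 : ℝ) < (2 * (d : ℝ)) ^ (k - 1) := by positivity
    have := mul_pos hd hp
    rwa [mul_assoc, div_mul_cancel₀ _ hp.ne'] at this

/-- ★★ **EVENTUAL ALTERNATION IN EVERY ORDER WINDOW**: for every `K`, for all sufficiently large `d`, `c_k^{(d)}·c_{k+1}^{(d)} < 0` for every
`1 ≤ k ≤ K` — the large-force expansion of `ℤ^{d+1}` alternates in sign through order `K + 1` once the dimension is large (contrast: on `ℤ²`,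
`c_{11} > 0` and `c_{12} > 0`). [cite: JansevanRensburgWhittington2013, §3.2 Theorem 8 (arXiv v4 p. 11)] -/
theorem eventually_alternating_largeForceCoeffZd (K : ℕ) :
    ∀ᶠ d : ℕ in atTop, ∀ k : ℕ, 1 ≤ k → k ≤ K → (largeForceCoeffZd d k : ℤ) * largeForceCoeffZd d (k + 1) < 0 := by
  have hall : ∀ᶠ d : ℕ in atTop, ∀ k ∈ Finset.Icc 1 (K + 1), (0 : ℝ) < (-1) ^ (k - 1) * ((largeForceCoeffZd d k : ℤ) : ℝ) := by
    refine (Finset.Icc 1 (K + 1)).eventually_all.2 fun k hk => ?_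
    exact eventually_sign_largeForceCoeffZd (Finset.mem_Icc.1 hk).1
  filter_upwards [hall] with d hd k hk1 hkK
  have h1 := hd k (Finset.mem_Icc.2 ⟨hk1, by omega⟩)
  have h2 := hd (k + 1) (Finset.mem_Icc.2 ⟨by omega, by omega⟩)
  have hprod := mul_pos h1 h2
  have hsign : ((-1 : ℝ) ^ (k - 1)) * (-1 : ℝ) ^ (k + 1 - 1) = -1 := by
    rw [show k + 1 - 1 = (k - 1) + 1 by omega, pow_succ, ← mul_assoc, ← mul_pow]; norm_num
  have : (0 : ℝ) < -(((largeForceCoeffZd d k : ℤ) : ℝ) * ((largeForceCoeffZd d (k + 1) : ℤ) : ℝ)) := by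
    have e : (-1 : ℝ) ^ (k - 1) * ((largeForceCoeffZd d k : ℤ) : ℝ) * ((-1) ^ (k + 1 - 1) * ((largeForceCoeffZd d (k + 1) : ℤ) : ℝ))
        = (((-1 : ℝ) ^ (k - 1)) * (-1 : ℝ) ^ (k + 1 - 1)) * (((largeForceCoeffZd d k : ℤ) : ℝ) * ((largeForceCoeffZd d (k + 1) : ℤ) : ℝ)) := by
      ring
    rw [e, hsign] at hprod
    linarith
  exact_mod_cast (neg_pos.1 this)

end Literature.Probability.RandomPlanarGeometry.SAW.Zd
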